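/-
Origin: expansion seat `planner-pub-hodgecm-pv03-0`, handover 2026-08-18T03:28:28Z (`HOME/pub-hodgecm-pv03/lean/Pv03/PerL34/LineFieldCore.lean`, md5 09c93cd1, 88 lines);
landed by the gen-5 packager in gate run 18 as `HodgeCM/PerL34/LineFieldCore.lean` (verbatim).
-/
/-
pub-hodgecm — DAG-node prover pv03 (session planner-pub-hodgecm-pv03-0).  Warm-up leaf for PerL v5 Prop 4.3
(`prop:S12`), the isotropy step of the line-field argument, tex ll. 677–680: "a `K_{x₀} ≅ U(2) × U(1)`-invariant
line in `T^*_{x₀}𝔹² ≅ ℂ²` — impossible (`SU(2)` is transitive on lines)".  Pure Mathlib; no HodgeCM import.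
-/
import Mathlib.Analysis.InnerProductSpace.Projection.Reflection
import Mathlib.Analysis.InnerProductSpace.Projection.Submodule
import Mathlib.Topology.Algebra.Module.FiniteDimension

set_option autoImplicit false

/-!
# No proper nonzero subspace of a finite-dimensional inner product space is invariant under all linear
# isometries

`HodgeCM.PerL34.LineFieldCore.exists_linearIsometryEquiv_apply_not_mem`: for a submodule `K` of a
finite-dimensional inner product space `E` over `𝕜 = ℝ` or `ℂ` with `K ≠ ⊥` and `K ≠ ⊤` there is a linear
isometry `g : E ≃ₗᵢ[𝕜] E` and `v ∈ K` with `g v ∉ K`.  The isometry is the reflection in the hyperplane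
`(𝕜 ∙ (v - w))ᗮ`, which swaps two orthogonal vectors `v ∈ K`, `w ∈ Kᗮ` of equal norm
(`reflection_sub_of_inner_eq_zero`, the `RCLike` version of Mathlib's real `Submodule.reflection_sub`).
Specialised to `E = ℂ²`, `K` a line: the unitary group `U(2)` (through which `K_{x₀} = U(2) × U(1)` acts on
`T^*_{x₀}𝔹²`) fixes no line — PerL v5 Prop 4.3, tex ll. 677–680.
-/

namespace HodgeCM.PerL34.LineFieldCore

open scoped InnerProductSpace

variable {𝕜 E : Type*} [RCLike 𝕜] [NormedAddCommGroup E] [InnerProductSpace 𝕜 E]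

local notation "⟪" x ", " y "⟫" => inner 𝕜 x y

/-- The reflection in the hyperplane `(𝕜 ∙ (v - w))ᗮ` maps `v` to `w` when `‖v‖ = ‖w‖` and `⟪v, w⟫ = 0`
(over `ℝ` the orthogonality is not needed: `Submodule.reflection_sub`). -/
theorem reflection_sub_of_inner_eq_zero {v w : E} [(𝕜 ∙ (v - w))ᗮ.HasOrthogonalProjection]
    (h : ‖v‖ = ‖w‖) (hvw : ⟪v, w⟫ = 0) :
    (𝕜 ∙ (v - w))ᗮ.reflection v = w := by
  set R : E ≃ₗᵢ[𝕜] E := (𝕜 ∙ (v - w))ᗮ.reflection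
  suffices hs : R v + R v = w + w by
    have h2 : (2 : 𝕜) • R v = (2 : 𝕜) • w := by simpa [two_smul] using hs
    exact smul_right_injective E (two_ne_zero' 𝕜) h2
  have hwv : ⟪w, v⟫ = 0 := by rw [← inner_conj_symm, hvw, map_zero]
  have h₁ : R (v - w) = -(v - w) := Submodule.reflection_orthogonalComplement_singleton_eq_neg (v - w)
  have h₂ : R (v + w) = v + w := by
    apply Submodule.reflection_mem_subspace_eq_self
    rw [Submodule.mem_orthogonal_singleton_iff_inner_right]
    simp only [inner_sub_left, inner_add_right, hvw, hwv, inner_self_eq_norm_sq_to_K, h]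
    ring
  have h₃ : R v + R v = R (v + w) + R (v - w) := by
    rw [map_add, map_sub]; abel
  rw [h₃, h₂, h₁]; abel

/-- **No proper nonzero subspace is invariant under every linear isometry** (finite-dimensional inner product
space over `ℝ` or `ℂ`).  For `E = ℂ²` and `K` a line this is the isotropy step of PerL v5 Prop 4.3
(tex ll. 677–680): `U(2)` fixes no line of `ℂ²`. -/
theorem exists_linearIsometryEquiv_apply_not_mem [FiniteDimensional 𝕜 E] (K : Submodule 𝕜 E)
    (hbot : K ≠ ⊥) (htop : K ≠ ⊤) : ∃ g : E ≃ₗᵢ[𝕜] E, ∃ v ∈ K, g v ∉ K := by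
  haveI : CompleteSpace K := FiniteDimensional.complete 𝕜 K
  obtain ⟨v, hvK, hv0⟩ := Submodule.exists_mem_ne_zero_of_ne_bot hbot
  have hKo : Kᗮ ≠ ⊥ := fun h => htop (Submodule.orthogonal_eq_bot_iff.mp h)
  obtain ⟨w₀, hw₀K, hw₀0⟩ := Submodule.exists_mem_ne_zero_of_ne_bot hKo
  set c : 𝕜 := ((‖v‖ / ‖w₀‖ : ℝ) : 𝕜) with hc
  set w : E := c • w₀ with hw
  have hwK : w ∈ Kᗮ := Kᗮ.smul_mem c hw₀K
  have hnorm : ‖v‖ = ‖w‖ := by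
    have hw₀n : ‖w₀‖ ≠ 0 := norm_ne_zero_iff.mpr hw₀0
    rw [hw, norm_smul, hc, RCLike.norm_ofReal, abs_of_nonneg (by positivity), div_mul_cancel₀ _ hw₀n]
  have hvw : ⟪v, w⟫ = 0 := Submodule.inner_right_of_mem_orthogonal hvK hwK
  haveI : CompleteSpace (𝕜 ∙ (v - w)) := FiniteDimensional.complete 𝕜 _
  refine ⟨(𝕜 ∙ (v - w))ᗮ.reflection, v, hvK, ?_⟩
  rw [reflection_sub_of_inner_eq_zero hnorm hvw]
  intro hwK'
  have hw0 : w = 0 := by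
    have h00 : ⟪w, w⟫ = 0 := Submodule.inner_right_of_mem_orthogonal hwK' hwK
    exact inner_self_eq_zero.mp h00
  apply hv0
  rw [← norm_eq_zero, hnorm, hw0, norm_zero]

/-- The form used in PerL v5 Prop 4.3 (tex ll. 677–680): in `ℂ²` (indeed in any finite-dimensional inner
product space) a LINE is moved by some linear isometry, provided the space is not itself a line. -/
theorem line_not_invariant [FiniteDimensional 𝕜 E] (K : Submodule 𝕜 E)
    (hK : Module.finrank 𝕜 K = 1) (hE : Module.finrank 𝕜 E ≠ 1) :
    ∃ g : E ≃ₗᵢ[𝕜] E, ∃ v ∈ K, g v ∉ K := by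
  refine exists_linearIsometryEquiv_apply_not_mem K ?_ ?_
  · intro h; rw [h, finrank_bot] at hK; exact zero_ne_one hK
  · intro h; rw [h, finrank_top] at hK; exact hE hK

end HodgeCM.PerL34.LineFieldCore
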